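import Summits.QuantumFields.YangMills.Theorems.ColdStartUniversalityLatticeLangevinTimeAverageHoeffdingUniform
import Summits.QuantumFields.YangMills.Theorems.ColdStartUniversalityLatticeLangevinDiscreteSamplingHoeffdingUniform
import Summits.QuantumFields.YangMills.Theorems.ColdStartUniversalityLatticeLangevinDiscreteSamplingHoeffding
import Summits.QuantumFields.YangMills.Theorems.ColdStartUniversalityLatticeLangevinLiebRobinsonWordLightCone
import Summits.QuantumFields.YangMills.Theorems.ColdStartUniversalityLatticeLangevinLiebRobinsonThreePointClustering
import Summits.QuantumFields.YangMills.Theorems.ColdStartUniversalityLatticeLangevinLiebRobinsonWordFarStart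
import HarnessLib

/-!
# Route `ColdStartUniversality` (fixed-cut-off SZZ dynamics): ★★★ HOEFFDING'S INEQUALITY FOR WILSON LOOPS ALONG THE COLD-START SAMPLER —
# every coupling (Harris constants), and VOLUME-FREE at `|β'| < 1/12` with the explicit loop constant `C_w = 12π²|w|³(6(7+6λ/ρ)³+2)`

Helper file (seat `ym-line-csu-p1`, g34; `--supports stmt-QuantumFields-24809`).  Specialisation of files 70/71 (Harris constants `C, c`) and
72/74 (volume-free) to THE observables of the route, Wilson loop words `w` (`Re tr` of a product of link matrices / adjoints along a list
`l : List (Edge 3 L × Bool)`, `|w| = l.length`, `|Re tr w| ≤ 2`): for EVERY strong solution of the SU(2) SZZ dynamics from a deterministic start on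
ANY probability space (in particular the cold start), every word `w`, all `T, ε > 0`, every step `h > 0` and every `N`:
* ★★★ `wilson_loop_timeAverage_deviation_le_exp` — `P[|T⁻¹∫_(0,T] Re tr w(U_r) dr − ⟨Re tr w⟩_(β')| ≥ ε] ≤ 2·exp(−c·T·ε²/(2304·C))` (every coupling);
* ★★★ `wilson_loop_average_deviation_le_exp` — `P[|N⁻¹Σ_(k<N) Re tr w(U_(kh)) − ⟨Re tr w⟩_(β')| ≥ ε] ≤ 2·exp(−N·ε²/(128·g²))`, `g = max(1, C/(1−e^(−ch)))`;
* ★★★ `wilson_loop_timeAverage_deviation_le_exp_uniform` — at `|β'| < 1/12`, for EVERY torus size `L`: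
  `P[|T⁻¹∫_(0,T] Re tr w(U_r) dr − ⟨Re tr w⟩_(β')| ≥ ε] ≤ 2·exp(−ρ·T·ε²/(2304·C_w))`, `ρ = 1 − 12|β'|`, `C_w = 12π²|w|³(6(7+6λ/ρ)³+2)`,
  `λ = (1300+4√2)|β'|` — e.g. a plaquette: `|w| = 4`;
* ★★★ `wilson_loop_average_deviation_le_exp_uniform` — at `|β'| < 1/12`: `≤ 2·exp(−N·ε²/(128·g_w²))`, `g_w = max(1, C_w/(1 − e^(−ρh/2)))`, every `L`.
Ingredients: `contDiff_word`, `abs_word_le_two`, `word_linkLipschitz_profile` (profile `2π|w|` on the links of the word; halved for `Re tr w/2`), and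
`C_f ≤ C_w` for the normalised word (`#Λ ≤ |w|`, `√(#Λ) ≤ |w|`).  THEOREMS ONLY, no definition, no sorry; [folklore] (Hoeffding bounds:
[cite: GlynnOrmoneit2002, Theorem 2]).  HONEST FRAMING: fixed cut-off; `C, c` depend on `L, β'`; the volume-free versions need `|β'| < 1/12`;
`UniformColdStartMixing` (24809) is NOT restated; no crux, rung or summit statement is proved; the Yang–Mills mass gap is NOT proved.
-/

set_option autoImplicit false

noncomputable section

namespace Summit.QuantumFields.YangMills.Theorems.ColdStartUniversality.LiebRobinson

open MeasureTheory ProbabilityTheory Filter Topology Set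
open scoped NNReal ENNReal BigOperators Matrix ComplexConjugate
open Literature Literature.Probability.Process Literature.MathematicalPhysics.QuantumFieldTheory
open Literature.MathematicalPhysics.QuantumFieldTheory.Balaban1983to89
open Literature.MathematicalPhysics.QuantumLattice (fundamentalRep fundamentalLatticeRep continuous_fundamentalRep fundamentalRep_apply)

variable {L : ℕ} [NeZero L]

/-! ## §1. The normalised word `Re tr w / 2`: continuity, `|·| ≤ 1`, halved link-Lipschitz profile, `C_f ≤ C_w` -/

/-- Halving a deviation event: `{ε ≤ |a/2 − b/2|} = {ε ≤ |a − b|/2}`-type identity. [folklore] -/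
theorem abs_half_sub_half (a b : ℝ) : |a / 2 - b / 2| = |a - b| / 2 := by
  rw [show a / 2 - b / 2 = (a - b) / 2 by ring, abs_div, abs_two]

/-- The sum of squares of the halved word profile: `Σ_e (π|w|·1_Λ(e))² = #Λ·(π|w|)²`. [folklore] -/
theorem sum_sq_halfProfile (Λ : Finset (Edge 3 L)) (a : ℝ) :
    ∑ e : Edge 3 L, (if e ∈ Λ then a else 0) ^ 2 = Λ.card * a ^ 2 := by
  classical
  have h1 : ∀ e : Edge 3 L, (if e ∈ Λ then a else 0) ^ 2 = if e ∈ Λ then a ^ 2 else 0 := fun e => by split_ifs <;> simp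
  simp_rw [h1]
  rw [Finset.sum_ite_mem, Finset.univ_inter, Finset.sum_const, nsmul_eq_mul]

/-- **`C_f ≤ C_w`** for the normalised word: with `Λ` the links of `w` (`#Λ ≤ |w|`) and profile `π|w|` on `Λ`,
`12π·#Λ·√(Σℓ²)·K ≤ 12π²|w|³·K` (`K ≥ 0`). [folklore] -/
theorem wordConstant_le (l : List (Edge 3 L × Bool)) {K : ℝ} (hK : 0 ≤ K) :
    12 * Real.pi * ((l.map Prod.fst).toFinset.card : ℝ) *
        Real.sqrt (∑ e : Edge 3 L, (if e ∈ (l.map Prod.fst).toFinset then Real.pi * (l.length : ℝ) else 0) ^ 2) * K ≤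
      12 * Real.pi ^ 2 * (l.length : ℝ) ^ 3 * K := by
  classical
  have hcard : (((l.map Prod.fst).toFinset.card : ℕ) : ℝ) ≤ l.length := by
    have h1 := List.toFinset_card_le (l.map Prod.fst)
    rw [List.length_map] at h1
    exact_mod_cast h1
  have hn : (0 : ℝ) ≤ l.length := by positivity
  rw [sum_sq_halfProfile, Real.sqrt_mul' _ (sq_nonneg _), Real.sqrt_sq (by positivity)]
  -- `√#Λ ≤ |w|`
  have hsqrt : Real.sqrt ((l.map Prod.fst).toFinset.card : ℝ) ≤ l.length := by
    rcases Nat.eq_zero_or_pos l.length with h0 | hpos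
    · have : (l.map Prod.fst).toFinset.card = 0 := by
        have := List.toFinset_card_le (l.map Prod.fst); rw [List.length_map, h0] at this; omega
      rw [this, h0]; simp
    · have h1 : (1 : ℝ) ≤ l.length := by exact_mod_cast hpos
      exact Real.sqrt_le_iff.2 ⟨hn, by nlinarith⟩
  refine mul_le_mul_of_nonneg_right ?_ hK
  calc 12 * Real.pi * ((l.map Prod.fst).toFinset.card : ℝ) * (Real.sqrt ((l.map Prod.fst).toFinset.card : ℝ) * (Real.pi * (l.length : ℝ)))
      ≤ 12 * Real.pi * (l.length : ℝ) * ((l.length : ℝ) * (Real.pi * (l.length : ℝ))) := by gcongr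
    _ = 12 * Real.pi ^ 2 * (l.length : ℝ) ^ 3 := by ring

/-! ## §2. Every coupling: Harris constants -/

/-- ★★★ **Hoeffding for time averages of a Wilson loop along the cold-start sampler** (every coupling; `C, c` depend on `L, β'`): for EVERY strong
solution from a deterministic start on ANY space, every word `w`, all `T, ε > 0`:
`P[|T⁻¹∫_(0,T] Re tr w(U_r) dr − ∫ Re tr w dμ_(β')| ≥ ε] ≤ 2·exp(−c·T·ε²/(2304·C))`. [cite: GlynnOrmoneit2002, Theorem 2] -/
theorem wilson_loop_timeAverage_deviation_le_exp (L : ℕ) [NeZero L] (β' : ℝ) :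
    ∃ C c : ℝ, 0 < C ∧ 0 < c ∧
      ∀ (x : GaugeConfig 3 L (Matrix.specialUnitaryGroup (Fin 2) ℂ))
        (Ω : Type) [MeasurableSpace Ω] (P : Measure Ω) [IsProbabilityMeasure P]
        (W : ℝ≥0 → Ω → (Edge 3 L × NoiseIdx 2 → ℝ)) (hW : IsFlatBrownian W P)
        (U : ℝ≥0 → Ω → GaugeConfig 3 L (Matrix.specialUnitaryGroup (Fin 2) ℂ)),
        (∀ ω, U 0 ω = x) →
        (latticeLangevinDynamics (fundamentalLatticeRep 2) β').IsSolution (fundamentalRep (Fin 2)) hW.natFiltration P W U →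
        ∀ (l : List (Edge 3 L × Bool)) (T : ℝ), 0 < T → ∀ (ε : ℝ), 0 < ε →
    let coords : GaugeConfig 3 L (Matrix.specialUnitaryGroup (Fin 2) ℂ) → (Edge 3 L × Fin 2 × Fin 2 × Bool → ℝ) :=
      fun V q => (fun z : ℂ => if q.2.2.2 then z.im else z.re)
        ((fundamentalRep (Fin 2) (V q.1) : Matrix (Fin 2) (Fin 2) ℂ) q.2.1 q.2.2.1)
    P.real {ω | ε ≤ |T⁻¹ * (∫ r in Ioc 0 T, (fun y : (Edge 3 L × Fin 2 × Fin 2 × Bool → ℝ) => ((l.map (fun a : Edge 3 L × Bool => if a.2 then ((fun (ee : Edge 3 L) => Matrix.of fun (i j : Fin 2) => ((y (ee, i, j, false) : ℝ) : ℂ) + ((y (ee, i, j, true) : ℝ) : ℂ) * Complex.I) a.1)ᴴ else (fun (ee : Edge 3 L) => Matrix.of fun (i j : Fin 2) => ((y (ee, i, j, false) : ℝ) : ℂ) + ((y (ee, i, j, true) : ℝ) : ℂ) * Complex.I) a.1)).prod).trace.re) (coords (U r.toNNReal ω))) - ∫ y, (fun y : (Edge 3 L × Fin 2 × Fin 2 ×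 Bool → ℝ) => ((l.map (fun a : Edge 3 L × Bool => if a.2 then ((fun (ee : Edge 3 L) => Matrix.of fun (i j : Fin 2) => ((y (ee, i, j, false) : ℝ) : ℂ) + ((y (ee, i, j, true) : ℝ) : ℂ) * Complex.I) a.1)ᴴ else (fun (ee : Edge 3 L) => Matrix.of fun (i j : Fin 2) => ((y (ee, i, j, false) : ℝ) : ℂ) + ((y (ee, i, j, true) : ℝ) : ℂ) * Complex.I) a.1)).prod).trace.re) (coords y) ∂(wilsonMeasure (d := 3) (L := L) (fundamentalRep (Fin 2)) β')|} ≤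
      2 * Real.exp (-(c * T * ε ^ 2) / (2304 * C)) := by
  obtain ⟨C, c, hC, hc, h⟩ := measureReal_timeAverage_deviation_le_exp L β'
  refine ⟨C, c, hC, hc, fun x Ω _ P _ W hW U hU0 hU l T hT ε hε => ?_⟩
  intro coords
  classical
  have hco : Continuous coords := continuous_coords (L := L)
  have hGc : Continuous fun V : (GaugeConfig 3 L (Matrix.specialUnitaryGroup (Fin 2) ℂ)) => (fun y : (Edge 3 L × Fin 2 × Fin 2 × Bool → ℝ) => ((l.map (fun a : Edge 3 L × Bool => if a.2 then ((fun (ee : Edge 3 L) => Matrix.of fun (i j : Fin 2) => ((y (ee, i, j, false) : ℝ) : ℂ) + ((y (ee, i, j, true) : ℝ) : ℂ) * Complex.I) a.1)ᴴ else (fun (ee : Edge 3 L) => Matrix.of fun (i j : Fin 2) => ((y (ee, i, j, false) : ℝ) : ℂ) + ((y (ee, i, j, true) : ℝ) : ℂ) * Complex.I) a.1)).prod).trace.re) (coords V) / 2 := ((contDiff_word (L := L) l (m := 0)).continuous.comp hco).div_const 2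
  have hG1 : ∀ V : (GaugeConfig 3 L (Matrix.specialUnitaryGroup (Fin 2) ℂ)), |(fun y : (Edge 3 L × Fin 2 × Fin 2 × Bool → ℝ) => ((l.map (fun a : Edge 3 L × Bool => if a.2 then ((fun (ee : Edge 3 L) => Matrix.of fun (i j : Fin 2) => ((y (ee, i, j, false) : ℝ) : ℂ) + ((y (ee, i, j, true) : ℝ) : ℂ) * Complex.I) a.1)ᴴ else (fun (ee : Edge 3 L) => Matrix.of fun (i j : Fin 2) => ((y (ee, i, j, false) : ℝ) : ℂ) + ((y (ee, i, j, true) : ℝ) : ℂ) * Complex.I) a.1)).prod).trace.re) (coords V) / 2| ≤ 1 := fun V => by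
    rw [abs_div, abs_two]
    have h2 := abs_word_le_two (L := L) l V
    linarith
  have h1 := h x Ω P W hW U hU0 hU (fun V => (fun y : (Edge 3 L × Fin 2 × Fin 2 × Bool → ℝ) => ((l.map (fun a : Edge 3 L × Bool => if a.2 then ((fun (ee : Edge 3 L) => Matrix.of fun (i j : Fin 2) => ((y (ee, i, j, false) : ℝ) : ℂ) + ((y (ee, i, j, true) : ℝ) : ℂ) * Complex.I) a.1)ᴴ else (fun (ee : Edge 3 L) => Matrix.of fun (i j : Fin 2) => ((y (ee, i, j, false) : ℝ) : ℂ) + ((y (ee, i, j, true) : ℝ) : ℂ) * Complex.I) a.1)).prod).trace.re) (coords V) / 2) hGc hG1 T hT (ε / 2) (by positivity)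
  have hset : {ω | ε ≤ |T⁻¹ * (∫ r in Ioc 0 T, (fun y : (Edge 3 L × Fin 2 × Fin 2 × Bool → ℝ) => ((l.map (fun a : Edge 3 L × Bool => if a.2 then ((fun (ee : Edge 3 L) => Matrix.of fun (i j : Fin 2) => ((y (ee, i, j, false) : ℝ) : ℂ) + ((y (ee, i, j, true) : ℝ) : ℂ) * Complex.I) a.1)ᴴ else (fun (ee : Edge 3 L) => Matrix.of fun (i j : Fin 2) => ((y (ee, i, j, false) : ℝ) : ℂ) + ((y (ee, i, j, true) : ℝ) : ℂ) * Complex.I) a.1)).prod).trace.re) (coords (U r.toNNReal ω))) - ∫ y, (fun y : (Edge 3 L × Fin 2 × Fin 2 × Bool → ℝ) => ((l.map (fun a : Edge 3 L × Bool => if a.2 then ((fun (ee : Edge 3 L) => Matrix.of fun (i j : Fin 2) => ((y (ee, i, j, false) : ℝ) : ℂ) + ((y (ee, i, j, true) : ℝ) : ℂ) * Complex.I) a.1)ᴴ else (fun (ee : Edge 3 L) => Matrix.of fun (i j : Fin 2) => ((y (ee, i, j, false) : ℝ) : ℂ) + ((y (ee, i, j, true) : ℝ) : ℂ) * Complex.I)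 a.1)).prod).trace.re) (coords y) ∂(wilsonMeasure (d := 3) (L := L) (fundamentalRep (Fin 2)) β')|} =
      {ω | ε / 2 ≤ |T⁻¹ * (∫ r in Ioc 0 T, (fun y : (Edge 3 L × Fin 2 × Fin 2 × Bool → ℝ) => ((l.map (fun a : Edge 3 L × Bool => if a.2 then ((fun (ee : Edge 3 L) => Matrix.of fun (i j : Fin 2) => ((y (ee, i, j, false) : ℝ) : ℂ) + ((y (ee, i, j, true) : ℝ) : ℂ) * Complex.I) a.1)ᴴ else (fun (ee : Edge 3 L) => Matrix.of fun (i j : Fin 2) => ((y (ee, i, j, false) : ℝ) : ℂ) + ((y (ee, i, j, true) : ℝ) : ℂ) * Complex.I) a.1)).prod).trace.re) (coords (U r.toNNReal ω)) / 2) - ∫ y, (fun y : (Edge 3 L × Fin 2 × Fin 2 × Bool → ℝ) => ((l.map (fun a : Edge 3 L × Bool => if a.2 then ((fun (ee : Edge 3 L) => Matrix.of fun (i j : Fin 2) => ((y (ee, i, j, false) : ℝ) : ℂ) + ((y (ee, i, j, true) : ℝ) : ℂ) * Complex.I) a.1)ᴴ else (fun (ee : Edge 3 L) => Matrix.of fun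 (i j : Fin 2) => ((y (ee, i, j, false) : ℝ) : ℂ) + ((y (ee, i, j, true) : ℝ) : ℂ) * Complex.I) a.1)).prod).trace.re) (coords y) / 2 ∂(wilsonMeasure (d := 3) (L := L) (fundamentalRep (Fin 2)) β')|} := by
    ext ω
    simp only [Set.mem_setOf_eq]
    rw [integral_div, integral_div, show T⁻¹ * ((∫ r in Ioc 0 T, (fun y : (Edge 3 L × Fin 2 × Fin 2 × Bool → ℝ) => ((l.map (fun a : Edge 3 L × Bool => if a.2 then ((fun (ee : Edge 3 L) => Matrix.of fun (i j : Fin 2) => ((y (ee, i, j, false) : ℝ) : ℂ) + ((y (ee, i, j, true) : ℝ) : ℂ) * Complex.I) a.1)ᴴ else (fun (ee : Edge 3 L) => Matrix.of fun (i j : Fin 2) => ((y (ee, i, j, false) : ℝ) : ℂ) + ((y (ee, i, j, true) : ℝ) : ℂ) * Complex.I) a.1)).prod).trace.re) (coords (U r.toNNReal ω))) / 2) =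
      (T⁻¹ * ∫ r in Ioc 0 T, (fun y : (Edge 3 L × Fin 2 × Fin 2 × Bool → ℝ) => ((l.map (fun a : Edge 3 L × Bool => if a.2 then ((fun (ee : Edge 3 L) => Matrix.of fun (i j : Fin 2) => ((y (ee, i, j, false) : ℝ) : ℂ) + ((y (ee, i, j, true) : ℝ) : ℂ) * Complex.I) a.1)ᴴ else (fun (ee : Edge 3 L) => Matrix.of fun (i j : Fin 2) => ((y (ee, i, j, false) : ℝ) : ℂ) + ((y (ee, i, j, true) : ℝ) : ℂ) * Complex.I) a.1)).prod).trace.re) (coords (U r.toNNReal ω))) / 2 by ring, abs_half_sub_half]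
    constructor <;> intro hh <;> linarith
  rw [hset]
  refine h1.trans (le_of_eq ?_)
  congr 1
  congr 1
  field_simp
  ring

/-- ★★★ **Hoeffding for discrete samples of a Wilson loop along the cold-start sampler** (every coupling; `C, c` depend on `L, β'`): for EVERY
strong solution from a deterministic start, every word `w`, every step `h > 0`, every `N`, every `ε > 0`, with `g = max(1, C/(1−e^(−ch)))`:
`P[|N⁻¹Σ_(k<N) Re tr w(U_(kh)) − ∫ Re tr w dμ_(β')| ≥ ε] ≤ 2·exp(−N·ε²/(128·g²))`. [cite: GlynnOrmoneit2002, Theorem 2] -/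
theorem wilson_loop_average_deviation_le_exp (L : ℕ) [NeZero L] (β' : ℝ) :
    ∃ C c : ℝ, 0 < C ∧ 0 < c ∧
      ∀ (x : GaugeConfig 3 L (Matrix.specialUnitaryGroup (Fin 2) ℂ))
        (Ω : Type) [MeasurableSpace Ω] (P : Measure Ω) [IsProbabilityMeasure P]
        (W : ℝ≥0 → Ω → (Edge 3 L × NoiseIdx 2 → ℝ)) (hW : IsFlatBrownian W P)
        (U : ℝ≥0 → Ω → GaugeConfig 3 L (Matrix.specialUnitaryGroup (Fin 2) ℂ)),
        (∀ ω, U 0 ω = x) →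
        (latticeLangevinDynamics (fundamentalLatticeRep 2) β').IsSolution (fundamentalRep (Fin 2)) hW.natFiltration P W U →
        ∀ (l : List (Edge 3 L × Bool)) (h : ℝ≥0), 0 < h → ∀ (N : ℕ) (ε : ℝ), 0 < ε →
    let coords : GaugeConfig 3 L (Matrix.specialUnitaryGroup (Fin 2) ℂ) → (Edge 3 L × Fin 2 × Fin 2 × Bool → ℝ) :=
      fun V q => (fun z : ℂ => if q.2.2.2 then z.im else z.re)
        ((fundamentalRep (Fin 2) (V q.1) : Matrix (Fin 2) (Fin 2) ℂ) q.2.1 q.2.2.1)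
    P.real {ω | ε ≤ |(N : ℝ)⁻¹ * (∑ k ∈ Finset.range N, (fun y : (Edge 3 L × Fin 2 × Fin 2 × Bool → ℝ) => ((l.map (fun a : Edge 3 L × Bool => if a.2 then ((fun (ee : Edge 3 L) => Matrix.of fun (i j : Fin 2) => ((y (ee, i, j, false) : ℝ) : ℂ) + ((y (ee, i, j, true) : ℝ) : ℂ) * Complex.I) a.1)ᴴ else (fun (ee : Edge 3 L) => Matrix.of fun (i j : Fin 2) => ((y (ee, i, j, false) : ℝ) : ℂ) + ((y (ee, i, j, true) : ℝ) : ℂ) * Complex.I) a.1)).prod).trace.re) (coords (U ((k : ℝ≥0) * h) ω))) - ∫ y, (fun y : (Edge 3 L × Fin 2 × Fin 2 × Bool → ℝ) => ((l.map (fun a : Edge 3 L × Bool => if a.2 then ((fun (ee : Edge 3 L) => Matrix.of fun (i j : Fin 2) => ((y (ee, i, j, false) : ℝ) : ℂ) + ((y (ee, i, j, true) : ℝ) : ℂ) * Complex.I) a.1)ᴴ else (fun (ee : Edge 3 L) => Matrix.of fun (i j : Fin 2) => ((y (ee, i, j, false) : ℝ) : ℂ) + ((y (ee, i, j, true) : ℝ)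 : ℂ) * Complex.I) a.1)).prod).trace.re) (coords y) ∂(wilsonMeasure (d := 3) (L := L) (fundamentalRep (Fin 2)) β')|} ≤
      2 * Real.exp (-(N * ε ^ 2) / (128 * max 1 (C / (1 - Real.exp (-c * h))) ^ 2)) := by
  obtain ⟨C, c, hC, hc, hF⟩ := measureReal_average_deviation_le_exp L β'
  refine ⟨C, c, hC, hc, fun x Ω _ P _ W hW U hU0 hU l h hh N ε hε => ?_⟩
  intro coords
  classical
  have hco : Continuous coords := continuous_coords (L := L)
  have hGm : Measurable fun V : (GaugeConfig 3 L (Matrix.specialUnitaryGroup (Fin 2) ℂ)) => (fun y : (Edge 3 L × Fin 2 × Fin 2 × Bool → ℝ) => ((l.map (fun a : Edge 3 L × Bool => if a.2 then ((fun (ee : Edge 3 L) => Matrix.of fun (i j : Fin 2) => ((y (ee, i, j, false) : ℝ) : ℂ) + ((y (ee, i, j, true) : ℝ) : ℂ) * Complex.I) a.1)ᴴ else (fun (ee : Edge 3 L) => Matrix.of fun (i j : Fin 2) => ((y (ee, i, j, false) : ℝ) : ℂ) + ((y (ee, i, j, true) : ℝ) : ℂ) * Complex.I) a.1)).prod).trace.re)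 (coords V) / 2 := (((contDiff_word (L := L) l (m := 0)).continuous.comp hco).div_const 2).measurable
  have hG1 : ∀ V : (GaugeConfig 3 L (Matrix.specialUnitaryGroup (Fin 2) ℂ)), |(fun y : (Edge 3 L × Fin 2 × Fin 2 × Bool → ℝ) => ((l.map (fun a : Edge 3 L × Bool => if a.2 then ((fun (ee : Edge 3 L) => Matrix.of fun (i j : Fin 2) => ((y (ee, i, j, false) : ℝ) : ℂ) + ((y (ee, i, j, true) : ℝ) : ℂ) * Complex.I) a.1)ᴴ else (fun (ee : Edge 3 L) => Matrix.of fun (i j : Fin 2) => ((y (ee, i, j, false) : ℝ) : ℂ) + ((y (ee, i, j, true) : ℝ) : ℂ) * Complex.I) a.1)).prod).trace.re) (coords V) / 2| ≤ 1 := fun V => by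
    rw [abs_div, abs_two]
    have h2 := abs_word_le_two (L := L) l V
    linarith
  have h1 := hF x Ω P W hW U hU0 hU (fun V => (fun y : (Edge 3 L × Fin 2 × Fin 2 × Bool → ℝ) => ((l.map (fun a : Edge 3 L × Bool => if a.2 then ((fun (ee : Edge 3 L) => Matrix.of fun (i j : Fin 2) => ((y (ee, i, j, false) : ℝ) : ℂ) + ((y (ee, i, j, true) : ℝ) : ℂ) * Complex.I) a.1)ᴴ else (fun (ee : Edge 3 L) => Matrix.of fun (i j : Fin 2) => ((y (ee, i, j, false) : ℝ) : ℂ) + ((y (ee, i, j, true) : ℝ) : ℂ) * Complex.I) a.1)).prod).trace.re) (coords V) / 2) hGm hG1 h hh N (ε / 2) (by positivity)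
  have hset : {ω | ε ≤ |(N : ℝ)⁻¹ * (∑ k ∈ Finset.range N, (fun y : (Edge 3 L × Fin 2 × Fin 2 × Bool → ℝ) => ((l.map (fun a : Edge 3 L × Bool => if a.2 then ((fun (ee : Edge 3 L) => Matrix.of fun (i j : Fin 2) => ((y (ee, i, j, false) : ℝ) : ℂ) + ((y (ee, i, j, true) : ℝ) : ℂ) * Complex.I) a.1)ᴴ else (fun (ee : Edge 3 L) => Matrix.of fun (i j : Fin 2) => ((y (ee, i, j, false) : ℝ) : ℂ) + ((y (ee, i, j, true) : ℝ) : ℂ) * Complex.I) a.1)).prod).trace.re) (coords (U ((k : ℝ≥0) * h) ω))) - ∫ y, (fun y : (Edge 3 L × Fin 2 × Fin 2 × Bool → ℝ) => ((l.map (fun a : Edge 3 L × Bool => if a.2 then ((fun (ee : Edge 3 L) => Matrix.of fun (i j : Fin 2) => ((y (ee, i, j, false) : ℝ) : ℂ) + ((y (ee, i, j, true) : ℝ) : ℂ) * Complex.I) a.1)ᴴ else (fun (ee : Edge 3 L) => Matrix.of fun (i j : Fin 2) => ((y (ee, i, j, false) : ℝ) : ℂ) + ((y (ee, i, j, true) :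 ℝ) : ℂ) * Complex.I) a.1)).prod).trace.re) (coords y) ∂(wilsonMeasure (d := 3) (L := L) (fundamentalRep (Fin 2)) β')|} =
      {ω | ε / 2 ≤ |(N : ℝ)⁻¹ * (∑ k ∈ Finset.range N, (fun y : (Edge 3 L × Fin 2 × Fin 2 × Bool → ℝ) => ((l.map (fun a : Edge 3 L × Bool => if a.2 then ((fun (ee : Edge 3 L) => Matrix.of fun (i j : Fin 2) => ((y (ee, i, j, false) : ℝ) : ℂ) + ((y (ee, i, j, true) : ℝ) : ℂ) * Complex.I) a.1)ᴴ else (fun (ee : Edge 3 L) => Matrix.of fun (i j : Fin 2) => ((y (ee, i, j, false) : ℝ) : ℂ) + ((y (ee, i, j, true) : ℝ) : ℂ) * Complex.I) a.1)).prod).trace.re) (coords (U ((k : ℝ≥0) * h) ω)) / 2) - ∫ y, (fun y : (Edge 3 L × Fin 2 × Fin 2 × Bool → ℝ) => ((l.map (fun a : Edge 3 L × Bool => if a.2 then ((fun (ee : Edge 3 L) => Matrix.of fun (i j : Fin 2) => ((y (ee, i, j, false) : ℝ) : ℂ) + ((y (ee, i, j, true) : ℝ) : ℂ) * Complex.I)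 a.1)ᴴ else (fun (ee : Edge 3 L) => Matrix.of fun (i j : Fin 2) => ((y (ee, i, j, false) : ℝ) : ℂ) + ((y (ee, i, j, true) : ℝ) : ℂ) * Complex.I) a.1)).prod).trace.re) (coords y) / 2 ∂(wilsonMeasure (d := 3) (L := L) (fundamentalRep (Fin 2)) β')|} := by
    ext ω
    simp only [Set.mem_setOf_eq]
    rw [integral_div, ← Finset.sum_div, show (N : ℝ)⁻¹ * ((∑ k ∈ Finset.range N, (fun y : (Edge 3 L × Fin 2 × Fin 2 × Bool → ℝ) => ((l.map (fun a : Edge 3 L × Bool => if a.2 then ((fun (ee : Edge 3 L) => Matrix.of fun (i j : Fin 2) => ((y (ee, i, j, false) : ℝ) : ℂ) + ((y (ee, i, j, true) : ℝ) : ℂ) * Complex.I) a.1)ᴴ else (fun (ee : Edge 3 L) => Matrix.of fun (i j : Fin 2) => ((y (ee, i, j, false) : ℝ) : ℂ) + ((y (ee, i, j, true) : ℝ) : ℂ) * Complex.I) a.1)).prod).trace.re) (coords (U ((k : ℝ≥0) * h) ω))) / 2) =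
      ((N : ℝ)⁻¹ * ∑ k ∈ Finset.range N, (fun y : (Edge 3 L × Fin 2 × Fin 2 × Bool → ℝ) => ((l.map (fun a : Edge 3 L × Bool => if a.2 then ((fun (ee : Edge 3 L) => Matrix.of fun (i j : Fin 2) => ((y (ee, i, j, false) : ℝ) : ℂ) + ((y (ee, i, j, true) : ℝ) : ℂ) * Complex.I) a.1)ᴴ else (fun (ee : Edge 3 L) => Matrix.of fun (i j : Fin 2) => ((y (ee, i, j, false) : ℝ) : ℂ) + ((y (ee, i, j, true) : ℝ) : ℂ) * Complex.I) a.1)).prod).trace.re) (coords (U ((k : ℝ≥0) * h) ω))) / 2 by ring, abs_half_sub_half]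
    constructor <;> intro hh' <;> linarith
  rw [hset]
  refine h1.trans (le_of_eq ?_)
  congr 1
  congr 1
  field_simp
  ring

/-! ## §3. `|β'| < 1/12`: volume-free Wilson-loop constants -/

/-- ★★★ **VOLUME-FREE Hoeffding for time averages of a Wilson loop at strong coupling.**  At `|β'| < 1/12`, for every torus size `L`, every strong
solution from a deterministic start on ANY space (e.g. the cold start), every word `w`, all `T, ε > 0`:
`P[|T⁻¹∫_(0,T] Re tr w(U_r) dr − ∫ Re tr w dμ_(β')| ≥ ε] ≤ 2·exp(−ρ·T·ε²/(2304·C_w))`, `ρ = 1 − 12|β'|`, `C_w = 12π²|w|³(6(7+6λ/ρ)³+2)`,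
`λ = (1300+4√2)|β'|` — independent of `L` and of the position of the loop. [cite: ChoiLi2019, Theorem 1.1] -/
theorem wilson_loop_timeAverage_deviation_le_exp_uniform (L : ℕ) [NeZero L] (β' : ℝ) (hβ : |β'| < 1 / 12)
    (x : GaugeConfig 3 L (Matrix.specialUnitaryGroup (Fin 2) ℂ))
    {Ω : Type} [MeasurableSpace Ω] {P : Measure Ω} [IsProbabilityMeasure P]
    {W : ℝ≥0 → Ω → (Edge 3 L × NoiseIdx 2 → ℝ)} (hW : IsFlatBrownian W P)
    {U : ℝ≥0 → Ω → GaugeConfig 3 L (Matrix.specialUnitaryGroup (Fin 2) ℂ)} (hU0 : ∀ ω, U 0 ω = x)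
    (hU : (latticeLangevinDynamics (fundamentalLatticeRep 2) β').IsSolution (fundamentalRep (Fin 2)) hW.natFiltration P W U)
    (l : List (Edge 3 L × Bool)) {T : ℝ} (hT : 0 < T) {ε : ℝ} (hε : 0 < ε) :
    let coords : GaugeConfig 3 L (Matrix.specialUnitaryGroup (Fin 2) ℂ) → (Edge 3 L × Fin 2 × Fin 2 × Bool → ℝ) :=
      fun V q => (fun z : ℂ => if q.2.2.2 then z.im else z.re)
        ((fundamentalRep (Fin 2) (V q.1) : Matrix (Fin 2) (Fin 2) ℂ) q.2.1 q.2.2.1)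
    P.real {ω | ε ≤ |T⁻¹ * (∫ r in Ioc 0 T, (fun y : (Edge 3 L × Fin 2 × Fin 2 × Bool → ℝ) => ((l.map (fun a : Edge 3 L × Bool => if a.2 then ((fun (ee : Edge 3 L) => Matrix.of fun (i j : Fin 2) => ((y (ee, i, j, false) : ℝ) : ℂ) + ((y (ee, i, j, true) : ℝ) : ℂ) * Complex.I) a.1)ᴴ else (fun (ee : Edge 3 L) => Matrix.of fun (i j : Fin 2) => ((y (ee, i, j, false) : ℝ) : ℂ) + ((y (ee, i, j, true) : ℝ) : ℂ) * Complex.I) a.1)).prod).trace.re) (coords (U r.toNNReal ω))) - ∫ y, (fun y : (Edge 3 L × Fin 2 × Fin 2 × Bool → ℝ) => ((l.map (fun a : Edge 3 L × Bool => if a.2 then ((fun (ee : Edge 3 L) => Matrix.of fun (i j : Fin 2) => ((y (ee, i, j, false) : ℝ) : ℂ) + ((y (ee, i, j, true) : ℝ) : ℂ) * Complex.I) a.1)ᴴ else (fun (ee : Edge 3 L) => Matrix.of fun (i j : Fin 2) => ((y (ee, i, j, false) : ℝ) : ℂ) + ((y (ee, i, j, true) : ℝ) : ℂ) * Complex.I)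 a.1)).prod).trace.re) (coords y) ∂(wilsonMeasure (d := 3) (L := L) (fundamentalRep (Fin 2)) β')|} ≤
      2 * Real.exp (-((1 - 12 * |β'|) * T * ε ^ 2) / (2304 * (12 * Real.pi ^ 2 * (l.length : ℝ) ^ 3 * (6 * (7 + 6 * ((1300 + 4 * Real.sqrt 2) * |β'|) / (1 - 12 * |β'|)) ^ 3 + 2)))) := by
  intro coords
  classical
  have hρ : 0 < 1 - 12 * |β'| := by linarith
  have hlam : 0 ≤ (1300 + 4 * Real.sqrt 2) * |β'| / (1 - 12 * |β'|) := div_nonneg (by positivity) hρ.le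
  have hKBpos : 0 < (6 * (7 + 6 * ((1300 + 4 * Real.sqrt 2) * |β'|) / (1 - 12 * |β'|)) ^ 3 + 2) := by
    have h7 : 0 ≤ (7 + 6 * ((1300 + 4 * Real.sqrt 2) * |β'|) / (1 - 12 * |β'|)) ^ 3 := by
      apply pow_nonneg
      have : 0 ≤ 6 * ((1300 + 4 * Real.sqrt 2) * |β'|) / (1 - 12 * |β'|) := by
        rw [mul_div_assoc]; exact mul_nonneg (by norm_num) hlam
      linarith
    linarith
  have hKB : 0 ≤ (6 * (7 + 6 * ((1300 + 4 * Real.sqrt 2) * |β'|) / (1 - 12 * |β'|)) ^ 3 + 2) := hKBpos.le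
  -- word facts, then abbreviate the word observable
  have hprof := word_linkLipschitz_profile L β' l
  have habs : ∀ V : (GaugeConfig 3 L (Matrix.specialUnitaryGroup (Fin 2) ℂ)), |(fun y : (Edge 3 L × Fin 2 × Fin 2 × Bool → ℝ) => ((l.map (fun a : Edge 3 L × Bool => if a.2 then ((fun (ee : Edge 3 L) => Matrix.of fun (i j : Fin 2) => ((y (ee, i, j, false) : ℝ) : ℂ) + ((y (ee, i, j, true) : ℝ) : ℂ) * Complex.I) a.1)ᴴ else (fun (ee : Edge 3 L) => Matrix.of fun (i j : Fin 2) => ((y (ee, i, j, false) : ℝ) : ℂ) + ((y (ee, i, j, true) : ℝ) : ℂ) * Complex.I) a.1)).prod).trace.re) (coords V)| ≤ 2 := fun V => abs_word_le_two (L := L) l V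
  have hcd : ContDiff ℝ 5 (fun y : (Edge 3 L × Fin 2 × Fin 2 × Bool → ℝ) => ((l.map (fun a : Edge 3 L × Bool => if a.2 then ((fun (ee : Edge 3 L) => Matrix.of fun (i j : Fin 2) => ((y (ee, i, j, false) : ℝ) : ℂ) + ((y (ee, i, j, true) : ℝ) : ℂ) * Complex.I) a.1)ᴴ else (fun (ee : Edge 3 L) => Matrix.of fun (i j : Fin 2) => ((y (ee, i, j, false) : ℝ) : ℂ) + ((y (ee, i, j, true) : ℝ) : ℂ) * Complex.I) a.1)).prod).trace.re) := contDiff_word (L := L) l (m := 5)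
  set wf : (Edge 3 L × Fin 2 × Fin 2 × Bool → ℝ) → ℝ := (fun y : (Edge 3 L × Fin 2 × Fin 2 × Bool → ℝ) => ((l.map (fun a : Edge 3 L × Bool => if a.2 then ((fun (ee : Edge 3 L) => Matrix.of fun (i j : Fin 2) => ((y (ee, i, j, false) : ℝ) : ℂ) + ((y (ee, i, j, true) : ℝ) : ℂ) * Complex.I) a.1)ᴴ else (fun (ee : Edge 3 L) => Matrix.of fun (i j : Fin 2) => ((y (ee, i, j, false) : ℝ) : ℂ) + ((y (ee, i, j, true) : ℝ) : ℂ) * Complex.I) a.1)).prod).trace.re) with hwf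
  -- the normalised word and its halved profile
  have hf : ContDiff ℝ 5 (fun y : (Edge 3 L × Fin 2 × Fin 2 × Bool → ℝ) => wf y / 2) := hcd.div_const 2
  have hℓ : ∀ e : Edge 3 L, 0 ≤ (if e ∈ (l.map Prod.fst).toFinset then Real.pi * (l.length : ℝ) else 0) := fun e => by
    split_ifs <;> positivity
  have hℓΛ : ∀ e : Edge 3 L, e ∉ (l.map Prod.fst).toFinset → (if e ∈ (l.map Prod.fst).toFinset then Real.pi * (l.length : ℝ) else 0) = 0 :=
    fun e he => if_neg he
  have hLip : ∀ (e : Edge 3 L) (y y' : (GaugeConfig 3 L (Matrix.specialUnitaryGroup (Fin 2) ℂ))), (∀ g, g ≠ e → y g = y' g) →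
      |(fun y : (Edge 3 L × Fin 2 × Fin 2 × Bool → ℝ) => wf y / 2) (coords y) - (fun y : (Edge 3 L × Fin 2 × Fin 2 × Bool → ℝ) => wf y / 2) (coords y')| ≤
        (if e ∈ (l.map Prod.fst).toFinset then Real.pi * (l.length : ℝ) else 0) * frobNorm ((y e : Matrix (Fin 2) (Fin 2) ℂ) - (y' e : Matrix (Fin 2) (Fin 2) ℂ)) := by
    intro e y y' hyy'
    have h1 : |wf (coords y) - wf (coords y')| ≤
        (if e ∈ (l.map Prod.fst).toFinset then 2 * Real.pi * (l.length : ℝ) else 0) * frobNorm ((y e : Matrix (Fin 2) (Fin 2) ℂ) - (y' e : Matrix (Fin 2) (Fin 2) ℂ)) :=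
      hprof e y y' hyy'
    have hhalf : (if e ∈ (l.map Prod.fst).toFinset then Real.pi * (l.length : ℝ) else 0) * frobNorm ((y e : Matrix (Fin 2) (Fin 2) ℂ) - (y' e : Matrix (Fin 2) (Fin 2) ℂ)) =
        (if e ∈ (l.map Prod.fst).toFinset then 2 * Real.pi * (l.length : ℝ) else 0) * frobNorm ((y e : Matrix (Fin 2) (Fin 2) ℂ) - (y' e : Matrix (Fin 2) (Fin 2) ℂ)) / 2 := by
      split_ifs <;> ring
    dsimp only
    rw [abs_half_sub_half, hhalf]
    exact div_le_div_of_nonneg_right h1 zero_le_two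
  have hf1 : ∀ V : (GaugeConfig 3 L (Matrix.specialUnitaryGroup (Fin 2) ℂ)), |(fun y : (Edge 3 L × Fin 2 × Fin 2 × Bool → ℝ) => wf y / 2) (coords V)| ≤ 1 := fun V => by
    dsimp only
    rw [abs_div, abs_two]
    linarith [habs V]
  have hmain := measureReal_timeAverage_deviation_le_exp_uniform_of_linkLipschitz L β' hβ x hW hU0 hU hf (l.map Prod.fst).toFinset hℓ hℓΛ hT
    (show 0 < ε / 2 by positivity) hLip hf1
  -- the event for `Re tr w` with `ε` is the event for `Re tr w / 2` with `ε/2`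
  have hset : {ω | ε ≤ |T⁻¹ * (∫ r in Ioc 0 T, wf (coords (U r.toNNReal ω))) - ∫ y, wf (coords y) ∂(wilsonMeasure (d := 3) (L := L) (fundamentalRep (Fin 2)) β')|} =
      {ω | ε / 2 ≤ |T⁻¹ * (∫ r in Ioc 0 T, (fun y : (Edge 3 L × Fin 2 × Fin 2 × Bool → ℝ) => wf y / 2) (coords (U r.toNNReal ω))) -
        ∫ y, (fun y : (Edge 3 L × Fin 2 × Fin 2 × Bool → ℝ) => wf y / 2) (coords y) ∂(wilsonMeasure (d := 3) (L := L) (fundamentalRep (Fin 2)) β')|} := by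
    ext ω
    simp only [Set.mem_setOf_eq]
    rw [integral_div, integral_div, show T⁻¹ * ((∫ r in Ioc 0 T, wf (coords (U r.toNNReal ω))) / 2) =
      (T⁻¹ * ∫ r in Ioc 0 T, wf (coords (U r.toNNReal ω))) / 2 by ring, abs_half_sub_half]
    constructor <;> intro hh <;> linarith
  rw [hset]
  -- compare the exponents: `C_f ≤ C_w`
  rcases Nat.eq_zero_or_pos l.length with h0 | hpos
  · have hl0 : (l.length : ℝ) = 0 := by exact_mod_cast h0
    have hR : -((1 - 12 * |β'|) * T * ε ^ 2) / (2304 * (12 * Real.pi ^ 2 * (l.length : ℝ) ^ 3 * (6 * (7 + 6 * ((1300 + 4 * Real.sqrt 2) * |β'|) / (1 - 12 * |β'|)) ^ 3 + 2))) = 0 := by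
      rw [hl0]; simp
    refine measureReal_le_one.trans ?_
    rw [hR, Real.exp_zero]
    norm_num
  have hl1 : (0 : ℝ) < l.length := by exact_mod_cast hpos
  have hCw : 0 < 12 * Real.pi ^ 2 * (l.length : ℝ) ^ 3 * (6 * (7 + 6 * ((1300 + 4 * Real.sqrt 2) * |β'|) / (1 - 12 * |β'|)) ^ 3 + 2) := mul_pos (by positivity) hKBpos
  have hle := wordConstant_le (L := L) l hKB
  have hCf : 0 < 12 * Real.pi * ((l.map Prod.fst).toFinset.card : ℝ) *
      Real.sqrt (∑ e : Edge 3 L, (if e ∈ (l.map Prod.fst).toFinset then Real.pi * (l.length : ℝ) else 0) ^ 2) * (6 * (7 + 6 * ((1300 + 4 * Real.sqrt 2) * |β'|) / (1 - 12 * |β'|)) ^ 3 + 2) := by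
    have hne : l ≠ [] := List.ne_nil_of_length_pos hpos
    obtain ⟨a, ha⟩ := List.exists_mem_of_ne_nil l hne
    have hmem : a.1 ∈ (l.map Prod.fst).toFinset := List.mem_toFinset.2 (List.mem_map.2 ⟨a, ha, rfl⟩)
    have hcard : (0 : ℝ) < (l.map Prod.fst).toFinset.card := by exact_mod_cast Finset.card_pos.2 ⟨a.1, hmem⟩
    have hsum : 0 < ∑ e : Edge 3 L, (if e ∈ (l.map Prod.fst).toFinset then Real.pi * (l.length : ℝ) else 0) ^ 2 := by
      rw [sum_sq_halfProfile]
      exact mul_pos hcard (pow_pos (mul_pos Real.pi_pos hl1) 2)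
    have hsq := Real.sqrt_pos.2 hsum
    exact mul_pos (mul_pos (mul_pos (mul_pos (by norm_num) Real.pi_pos) hcard) hsq) hKBpos
  refine hmain.trans (mul_le_mul_of_nonneg_left (Real.exp_le_exp.2 ?_) (by norm_num))
  rw [neg_div, neg_div, neg_le_neg_iff, div_le_div_iff₀ (mul_pos (by norm_num) hCw) (mul_pos (by norm_num) hCf)]
  have hε2 : (1 - 12 * |β'|) * T * (ε / 2) ^ 2 * (2304 * (12 * Real.pi ^ 2 * (l.length : ℝ) ^ 3 * (6 * (7 + 6 * ((1300 + 4 * Real.sqrt 2) * |β'|) / (1 - 12 * |β'|)) ^ 3 + 2))) =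
      (1 - 12 * |β'|) * T * ε ^ 2 * (576 * (12 * Real.pi ^ 2 * (l.length : ℝ) ^ 3 * (6 * (7 + 6 * ((1300 + 4 * Real.sqrt 2) * |β'|) / (1 - 12 * |β'|)) ^ 3 + 2))) := by ring
  rw [hε2]
  have hpos' : 0 ≤ (1 - 12 * |β'|) * T * ε ^ 2 := mul_nonneg (mul_nonneg hρ.le hT.le) (sq_nonneg ε)
  exact mul_le_mul_of_nonneg_left (by linarith) hpos'

/-- ★★★ **VOLUME-FREE Hoeffding for discrete samples of a Wilson loop at strong coupling.**  At `|β'| < 1/12`, for every torus size `L`, every strong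
solution from a deterministic start, every word `w`, every step `h > 0`, every `N`, `ε > 0`, with `C_w = 12π²|w|³(6(7+6λ/ρ)³+2)`, `ρ = 1 − 12|β'|`,
`g_w = max(1, C_w/(1 − e^(−ρh/2)))`: `P[|N⁻¹Σ_(k<N) Re tr w(U_(kh)) − ∫ Re tr w dμ_(β')| ≥ ε] ≤ 2·exp(−N·ε²/(128·g_w²))`. [cite: GlynnOrmoneit2002, Theorem 2] -/
theorem wilson_loop_average_deviation_le_exp_uniform (L : ℕ) [NeZero L] (β' : ℝ) (hβ : |β'| < 1 / 12)
    (x : GaugeConfig 3 L (Matrix.specialUnitaryGroup (Fin 2) ℂ))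
    {Ω : Type} [MeasurableSpace Ω] {P : Measure Ω} [IsProbabilityMeasure P]
    {W : ℝ≥0 → Ω → (Edge 3 L × NoiseIdx 2 → ℝ)} (hW : IsFlatBrownian W P)
    {U : ℝ≥0 → Ω → GaugeConfig 3 L (Matrix.specialUnitaryGroup (Fin 2) ℂ)} (hU0 : ∀ ω, U 0 ω = x)
    (hU : (latticeLangevinDynamics (fundamentalLatticeRep 2) β').IsSolution (fundamentalRep (Fin 2)) hW.natFiltration P W U)
    (l : List (Edge 3 L × Bool)) {h : ℝ≥0} (hh : 0 < h) (N : ℕ) {ε : ℝ} (hε : 0 < ε) :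
    let coords : GaugeConfig 3 L (Matrix.specialUnitaryGroup (Fin 2) ℂ) → (Edge 3 L × Fin 2 × Fin 2 × Bool → ℝ) :=
      fun V q => (fun z : ℂ => if q.2.2.2 then z.im else z.re)
        ((fundamentalRep (Fin 2) (V q.1) : Matrix (Fin 2) (Fin 2) ℂ) q.2.1 q.2.2.1)
    P.real {ω | ε ≤ |(N : ℝ)⁻¹ * (∑ k ∈ Finset.range N, (fun y : (Edge 3 L × Fin 2 × Fin 2 × Bool → ℝ) => ((l.map (fun a : Edge 3 L × Bool => if a.2 then ((fun (ee : Edge 3 L) => Matrix.of fun (i j : Fin 2) => ((y (ee, i, j, false) : ℝ) : ℂ) + ((y (ee, i, j, true) : ℝ) : ℂ) * Complex.I) a.1)ᴴ else (fun (ee : Edge 3 L) => Matrix.of fun (i j : Fin 2) => ((y (ee, i, j, false) : ℝ) : ℂ) + ((y (ee, i, j, true) : ℝ) : ℂ) * Complex.I) a.1)).prod).trace.re) (coords (U ((k : ℝ≥0) * h) ω))) - ∫ y, (fun y : (Edge 3 L × Fin 2 × Fin 2 × Bool → ℝ) => ((l.map (fun a : Edge 3 L × Bool => if a.2 then ((fun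 (ee : Edge 3 L) => Matrix.of fun (i j : Fin 2) => ((y (ee, i, j, false) : ℝ) : ℂ) + ((y (ee, i, j, true) : ℝ) : ℂ) * Complex.I) a.1)ᴴ else (fun (ee : Edge 3 L) => Matrix.of fun (i j : Fin 2) => ((y (ee, i, j, false) : ℝ) : ℂ) + ((y (ee, i, j, true) : ℝ) : ℂ) * Complex.I) a.1)).prod).trace.re) (coords y) ∂(wilsonMeasure (d := 3) (L := L) (fundamentalRep (Fin 2)) β')|} ≤
      2 * Real.exp (-(N * ε ^ 2) / (128 * max 1 ((12 * Real.pi ^ 2 * (l.length : ℝ) ^ 3 * (6 * (7 + 6 * ((1300 + 4 * Real.sqrt 2) * |β'|) / (1 - 12 * |β'|)) ^ 3 + 2)) /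
        (1 - Real.exp (-((1 - 12 * |β'|) / 2) * h))) ^ 2)) := by
  intro coords
  classical
  haveI := secondCountableTopology_su2
  haveI := borelSpace_config L
  have hρ : 0 < 1 - 12 * |β'| := by linarith
  have hlam : 0 ≤ (1300 + 4 * Real.sqrt 2) * |β'| / (1 - 12 * |β'|) := div_nonneg (by positivity) hρ.le
  have hKBpos : 0 < (6 * (7 + 6 * ((1300 + 4 * Real.sqrt 2) * |β'|) / (1 - 12 * |β'|)) ^ 3 + 2) := by
    have h7 : 0 ≤ (7 + 6 * ((1300 + 4 * Real.sqrt 2) * |β'|) / (1 - 12 * |β'|)) ^ 3 := by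
      apply pow_nonneg
      have : 0 ≤ 6 * ((1300 + 4 * Real.sqrt 2) * |β'|) / (1 - 12 * |β'|) := by
        rw [mul_div_assoc]; exact mul_nonneg (by norm_num) hlam
      linarith
    linarith
  have hKB : 0 ≤ (6 * (7 + 6 * ((1300 + 4 * Real.sqrt 2) * |β'|) / (1 - 12 * |β'|)) ^ 3 + 2) := hKBpos.le
  obtain ⟨κ, hκM, hκ0, hreal⟩ := exists_transitionKernel L β'
  haveI := hκM
  have hco : Continuous coords := continuous_coords (L := L)
  -- word facts, then abbreviate the word observable
  have hmw := wilson_word_mixing_halfRate L β' hβ κ hreal l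
  have habs : ∀ V : (GaugeConfig 3 L (Matrix.specialUnitaryGroup (Fin 2) ℂ)), |(fun y : (Edge 3 L × Fin 2 × Fin 2 × Bool → ℝ) => ((l.map (fun a : Edge 3 L × Bool => if a.2 then ((fun (ee : Edge 3 L) => Matrix.of fun (i j : Fin 2) => ((y (ee, i, j, false) : ℝ) : ℂ) + ((y (ee, i, j, true) : ℝ) : ℂ) * Complex.I) a.1)ᴴ else (fun (ee : Edge 3 L) => Matrix.of fun (i j : Fin 2) => ((y (ee, i, j, false) : ℝ) : ℂ) + ((y (ee, i, j, true) : ℝ) : ℂ) * Complex.I) a.1)).prod).trace.re) (coords V)| ≤ 2 := fun V => abs_word_le_two (L := L) l V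
  have hcd : ContDiff ℝ 0 (fun y : (Edge 3 L × Fin 2 × Fin 2 × Bool → ℝ) => ((l.map (fun a : Edge 3 L × Bool => if a.2 then ((fun (ee : Edge 3 L) => Matrix.of fun (i j : Fin 2) => ((y (ee, i, j, false) : ℝ) : ℂ) + ((y (ee, i, j, true) : ℝ) : ℂ) * Complex.I) a.1)ᴴ else (fun (ee : Edge 3 L) => Matrix.of fun (i j : Fin 2) => ((y (ee, i, j, false) : ℝ) : ℂ) + ((y (ee, i, j, true) : ℝ) : ℂ) * Complex.I) a.1)).prod).trace.re) := contDiff_word (L := L) l (m := 0)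
  set wf : (Edge 3 L × Fin 2 × Fin 2 × Bool → ℝ) → ℝ := (fun y : (Edge 3 L × Fin 2 × Fin 2 × Bool → ℝ) => ((l.map (fun a : Edge 3 L × Bool => if a.2 then ((fun (ee : Edge 3 L) => Matrix.of fun (i j : Fin 2) => ((y (ee, i, j, false) : ℝ) : ℂ) + ((y (ee, i, j, true) : ℝ) : ℂ) * Complex.I) a.1)ᴴ else (fun (ee : Edge 3 L) => Matrix.of fun (i j : Fin 2) => ((y (ee, i, j, false) : ℝ) : ℂ) + ((y (ee, i, j, true) : ℝ) : ℂ) * Complex.I) a.1)).prod).trace.re) with hwf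
  have hGm : Measurable fun V : (GaugeConfig 3 L (Matrix.specialUnitaryGroup (Fin 2) ℂ)) => wf (coords V) / 2 := ((hcd.continuous.comp hco).div_const 2).measurable
  have hG1 : ∀ V : (GaugeConfig 3 L (Matrix.specialUnitaryGroup (Fin 2) ℂ)), |wf (coords V) / 2| ≤ 1 := fun V => by
    rw [abs_div, abs_two]
    linarith [habs V]
  -- volume-free mixing bound of the normalised word with constant `≤ C_w`
  have hCwnn : 0 ≤ 12 * Real.pi ^ 2 * (l.length : ℝ) ^ 3 * (6 * (7 + 6 * ((1300 + 4 * Real.sqrt 2) * |β'|) / (1 - 12 * |β'|)) ^ 3 + 2) := mul_nonneg (by positivity) hKB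
  have h2 : 12 * Real.sqrt 2 * Real.pi * (l.length : ℝ) ^ 2 * (6 * (7 + 6 * ((1300 + 4 * Real.sqrt 2) * |β'|) / (1 - 12 * |β'|)) ^ 3 + 2) ≤ 2 * (12 * Real.pi ^ 2 * (l.length : ℝ) ^ 3 * (6 * (7 + 6 * ((1300 + 4 * Real.sqrt 2) * |β'|) / (1 - 12 * |β'|)) ^ 3 + 2)) := by
    rcases Nat.eq_zero_or_pos l.length with h0 | hpos
    · have hl0 : (l.length : ℝ) = 0 := by exact_mod_cast h0
      rw [hl0]; simp
    have hn1 : (1 : ℝ) ≤ l.length := by exact_mod_cast hpos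
    have hs2 : Real.sqrt 2 ≤ 2 := by
      rw [show (2 : ℝ) = Real.sqrt 4 by rw [show (4 : ℝ) = 2 ^ 2 by norm_num, Real.sqrt_sq (by norm_num)]]
      exact Real.sqrt_le_sqrt (by norm_num)
    have hpi : (3 : ℝ) ≤ Real.pi := by linarith [Real.pi_gt_three]
    have hn2 : (l.length : ℝ) ^ 2 ≤ (l.length : ℝ) ^ 3 := by nlinarith
    have hA : 12 * Real.sqrt 2 * Real.pi * (l.length : ℝ) ^ 2 ≤ 2 * (12 * Real.pi ^ 2 * (l.length : ℝ) ^ 3) := by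
      calc 12 * Real.sqrt 2 * Real.pi * (l.length : ℝ) ^ 2 ≤ 12 * 2 * Real.pi * (l.length : ℝ) ^ 3 := by gcongr
        _ ≤ 12 * 2 * Real.pi * (l.length : ℝ) ^ 3 * (Real.pi / 3) := by
            have : (1 : ℝ) ≤ Real.pi / 3 := by rw [le_div_iff₀ (by norm_num : (0:ℝ) < 3)]; linarith
            have h0 : 0 ≤ 12 * 2 * Real.pi * (l.length : ℝ) ^ 3 := by positivity
            nlinarith
        _ = 2 * (12 * Real.pi ^ 2 * (l.length : ℝ) ^ 3) * (1 / 3) := by ring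
        _ ≤ 2 * (12 * Real.pi ^ 2 * (l.length : ℝ) ^ 3) := by
            have h0 : 0 ≤ 2 * (12 * Real.pi ^ 2 * (l.length : ℝ) ^ 3) := by positivity
            nlinarith
    calc 12 * Real.sqrt 2 * Real.pi * (l.length : ℝ) ^ 2 * (6 * (7 + 6 * ((1300 + 4 * Real.sqrt 2) * |β'|) / (1 - 12 * |β'|)) ^ 3 + 2) = (12 * Real.sqrt 2 * Real.pi * (l.length : ℝ) ^ 2) * (6 * (7 + 6 * ((1300 + 4 * Real.sqrt 2) * |β'|) / (1 - 12 * |β'|)) ^ 3 + 2) := by ring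
      _ ≤ (2 * (12 * Real.pi ^ 2 * (l.length : ℝ) ^ 3)) * (6 * (7 + 6 * ((1300 + 4 * Real.sqrt 2) * |β'|) / (1 - 12 * |β'|)) ^ 3 + 2) := mul_le_mul_of_nonneg_right hA hKB
      _ = 2 * (12 * Real.pi ^ 2 * (l.length : ℝ) ^ 3 * (6 * (7 + 6 * ((1300 + 4 * Real.sqrt 2) * |β'|) / (1 - 12 * |β'|)) ^ 3 + 2)) := by ring
  have hmixG : ∀ (t : ℝ≥0) (y : (GaugeConfig 3 L (Matrix.specialUnitaryGroup (Fin 2) ℂ))), |(∫ z, wf (coords z) / 2 ∂(κ t y)) - ∫ z, wf (coords z) / 2 ∂(wilsonMeasure (d := 3) (L := L) (fundamentalRep (Fin 2)) β')| ≤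
      (12 * Real.pi ^ 2 * (l.length : ℝ) ^ 3 * (6 * (7 + 6 * ((1300 + 4 * Real.sqrt 2) * |β'|) / (1 - 12 * |β'|)) ^ 3 + 2)) * Real.exp (-((1 - 12 * |β'|) / 2) * t) := by
    intro t y
    have h1 : |(∫ z, wf (coords z) ∂(κ t y)) - ∫ z, wf (coords z) ∂(wilsonMeasure (d := 3) (L := L) (fundamentalRep (Fin 2)) β')| ≤
        12 * Real.sqrt 2 * Real.pi * (l.length : ℝ) ^ 2 * (6 * (7 + 6 * ((1300 + 4 * Real.sqrt 2) * |β'|) / (1 - 12 * |β'|)) ^ 3 + 2) * Real.exp (-((1 - 12 * |β'|) / 2 * (t : ℝ))) := hmw t y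
    rw [integral_div, integral_div, abs_half_sub_half, neg_mul]
    calc |(∫ z, wf (coords z) ∂(κ t y)) - ∫ z, wf (coords z) ∂(wilsonMeasure (d := 3) (L := L) (fundamentalRep (Fin 2)) β')| / 2
        ≤ 12 * Real.sqrt 2 * Real.pi * (l.length : ℝ) ^ 2 * (6 * (7 + 6 * ((1300 + 4 * Real.sqrt 2) * |β'|) / (1 - 12 * |β'|)) ^ 3 + 2) * Real.exp (-((1 - 12 * |β'|) / 2 * (t : ℝ))) / 2 := div_le_div_of_nonneg_right h1 zero_le_two
      _ ≤ 2 * (12 * Real.pi ^ 2 * (l.length : ℝ) ^ 3 * (6 * (7 + 6 * ((1300 + 4 * Real.sqrt 2) * |β'|) / (1 - 12 * |β'|)) ^ 3 + 2)) * Real.exp (-((1 - 12 * |β'|) / 2 * (t : ℝ))) / 2 := by gcongr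
      _ = (12 * Real.pi ^ 2 * (l.length : ℝ) ^ 3 * (6 * (7 + 6 * ((1300 + 4 * Real.sqrt 2) * |β'|) / (1 - 12 * |β'|)) ^ 3 + 2)) * Real.exp (-((1 - 12 * |β'|) / 2 * (t : ℝ))) := by ring
  have hmain := measureReal_average_deviation_le_exp_of_mixing_bound β' κ hκ0 hreal x hW hU0 hU hGm hG1 hCwnn (half_pos hρ)
    hmixG hh N (show 0 < ε / 2 by positivity)
  have hset : {ω | ε ≤ |(N : ℝ)⁻¹ * (∑ k ∈ Finset.range N, wf (coords (U ((k : ℝ≥0) * h) ω))) - ∫ y, wf (coords y) ∂(wilsonMeasure (d := 3) (L := L) (fundamentalRep (Fin 2)) β')|} =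
      {ω | ε / 2 ≤ |(N : ℝ)⁻¹ * (∑ k ∈ Finset.range N, wf (coords (U ((k : ℝ≥0) * h) ω)) / 2) - ∫ y, wf (coords y) / 2 ∂(wilsonMeasure (d := 3) (L := L) (fundamentalRep (Fin 2)) β')|} := by
    ext ω
    simp only [Set.mem_setOf_eq]
    rw [integral_div, ← Finset.sum_div, show (N : ℝ)⁻¹ * ((∑ k ∈ Finset.range N, wf (coords (U ((k : ℝ≥0) * h) ω))) / 2) =
      ((N : ℝ)⁻¹ * ∑ k ∈ Finset.range N, wf (coords (U ((k : ℝ≥0) * h) ω))) / 2 by ring, abs_half_sub_half]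
    constructor <;> intro hh' <;> linarith
  rw [hset]
  refine hmain.trans (le_of_eq ?_)
  congr 1
  congr 1
  field_simp
  ring

end Summit.QuantumFields.YangMills.Theorems.ColdStartUniversality.LiebRobinson

end
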